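import Mathlib
import Summits.Langlands.Langlands.Theses.PicardMuOrdinary
import Literature.NumberTheory.GaloisRepresentations.GaloisRep
import Literature.NumberTheory.Automorphic.ReciprocityGLnProofs
import Literature.NumberTheory.Automorphic.AsaiSign
import Literature.NumberTheory.Automorphic.BaseChangeCyclicCuspidal
import Literature.NumberTheory.Automorphic.BaseChangeStrongUnramified
import Literature.NumberTheory.Automorphic.BaseChangeArchimedean
import Literature.NumberTheory.Automorphic.GLnAdelicStructureProofs
import Summits.Langlands.Langlands.Theorems.PicardMuOrdinaryIrregularClassicalityBaseChangeToLField
import Summits.Langlands.Langlands.Theorems.PicardMuOrdinaryIrregularClassicalityBaseChangeToLTower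
import HarnessLib

/-!
# Stub `stub_baseChangeToL` of line `split-ramified-prime-sqrt6`: base change of a polarized
# tower to `L = K(√-2)`, in Galois-convergent form — conditional reduction to named facts

Crux `Summit.Langlands.Langlands.Theses.PicardMuOrdinary.IrregularClassicality` (stmt-Langlands-13758),
Stub 4 of the checked skeleton.  `K = ℚ(ω) = CyclotomicField 3 ℚ`, `ℤ̄ = integralClosure ℤ ℂ`,
`ℚ̄₃ = PadicAlgCl 3`.  The registered statement is proved here CONDITIONALLY on four named facts of
the tree, taken by name as leading hypotheses (`stub_baseChangeToL`):

* `baseChange_cyclic_cuspidal` — Arthur–Clozel, Ch. 3 Thm. 4.2 (a): the base change of a cuspidal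
  `π` with `π ≇ π ⊗ η` along a cyclic extension of prime degree is CUSPIDAL (datum model);
* `ArthurClozel1989_strongLifting_unramified` — Thm. 5.1 at the finite places unramified in `E/F`:
  a weak lift of cuspidal data is an unramified STRONG lift, `Sat(Π, w) = Sat(π, v)^{f(w|v)}` at every
  `w` over an unramified `v` where `π` is unramified (this is what makes the level `S_L` below
  independent of `k`);
* `ArthurClozel1989_strongLifting_archimedean` — Thm. 5.1, archimedean clause: regular algebraicity
  ascends;
* `exists_galoisRep_of_regularAlgebraic` — lang.S27 (Harris–Lan–Taylor–Thorne + Varma): the Galois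
  representation `r_{3,ι}(π)` of a regular algebraic cuspidal `π` over a CM field, compatible at
  every unramified `v ∤ 3`.

**Proof** (`tower_baseChange`, for any quadratic `E/F` with `F` CM and compatible involutions
`c|_F = c₀`; then `F = K`, `E = L = K[X]/(X² + 2)` with `s = √-2`, `c`, `IsCMField L`, `[L : K] = 2`
from `exists_cmField_sqrt_neg_two` of the support file `…BaseChangeToLField`, and
`hcptL = isCompact_glFiniteIntegralLevel_holds`).
Put `S_E := {w : w ∩ 𝓞 F ∈ S ∪ S₀ ∪ Ram(E/F)}` (finite, independent of `k`; it contains the places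
over `3` since `S₀` does).  Given the `k`-th member `P` of the tower (cuspidal, regular algebraic,
`IsConjSelfDualAE c₀`, Satake parameter `α_𝔭` with `N𝔭·Σα_𝔭 ≡ a(𝔭)` modulo `3^k ℤ̄_𝔐` off `S`):
(1) at an inert place `v ∉` (ramification of `P`) — infinitely many by Chebotarev — the Satake
parameter satisfies `-α ≠ α` (rank `3` is odd, Satake eigenvalues are non-zero), so
`Π := BC_{E/F}(P)` is CUSPIDAL (`baseChange_cyclic_cuspidal`); (2) it is an unramified strong lift
(`ArthurClozel1989_strongLifting_unramified`), hence regular algebraic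
(`ArthurClozel1989_strongLifting_archimedean`), unramified at every `w ∉ S_E`, and conjugate
self-dual for `c` (`isConjSelfDualAE_of_isUnramifiedBaseChangeLift`:
`Sat(Π, c•w) = Sat(P, c₀•v)^f = (Sat(P,v)⁻¹)^f`); (3) `r_F := r_{3,ι}(P)` over `F` (lang.S27, `F` CM)
and `r := r_F|_{Γ_E}`: at `w ∉ S_E` over `v` (`v ∉ S ∪ S₀`, unramified in `E`, `v ∤ 3`) the
compatibility of `r_F` with `P` at `v` restricts to compatibility of `r` with `Π` at `w`
(`isGaloisCompatibleAt_restrictField`: `charpoly Frob_w = ∏ (X - b^f)`); (4) at every arithmetic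
Frobenius `σ` over `v ∉ S ∪ S₀`, `tr r_F(σ⁻¹) = ι⁻¹(N v·Σα_v)` and `tr ρ(σ⁻¹) = ι⁻¹(a v)`, whose
difference `ι⁻¹(t)` has norm `≤ 3^{-k}` by the adaptedness of `ι` to `𝔐` (`u t ∈ (3^k)`, `u ∉ 𝔐`);
these Frobenii are dense in `Γ_F` (Chebotarev, proved: `frobenius_dense`,
`chebotarev_artinRep_holds`) and traces are continuous, so `‖tr r_F - tr ρ‖ ≤ 3^{-k}` on `Γ_F`, in
particular on the image of `Γ_E`.

References: J. Arthur, L. Clozel, Ann. of Math. Stud. 120 (1989), Ch. 3, Thm. 4.2 (a), Thm. 5.1;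
M. Harris, K.-W. Lan, R. Taylor, J. Thorne, Res. Math. Sci. 3 (2016), Thm. A; I. Varma, Forum Math.
Sigma 12 (2024); J.-P. Serre, *Abelian ℓ-adic representations* (1968), Ch. I §2.2.
-/

open scoped MatrixGroups Classical
open Literature.NumberTheory.GaloisRepresentations Literature.NumberTheory.Automorphic
open IsDedekindDomain NumberField Polynomial Filter

set_option linter.dupNamespace false -- project-wide: `Summit.Langlands.Langlands` is the mandated namespace

noncomputable section

namespace Summit.Langlands.Langlands.Theorems.IrregularClassicality.SplitRamifiedPrimeSqrt6

/-! ## The general tower theorem along a quadratic extension -/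

/-- **Base change of a polarized congruence tower along a quadratic extension `E/F`** (`F` totally
real or CM), in Galois-convergent form, from the four named facts: a level `S_E` (independent of
`k`, containing the places over `3` and over `S₀`) and, for every `k`, a cuspidal regular algebraic
`c`-conjugate-self-dual `Π_k` on `GL₃(𝔸_E)` unramified and compatible with `r_k = r_{3,ι}(P_k)|_{Γ_E}`
outside `S_E`, with `‖tr r_k - tr ρ|_{Γ_E}‖ ≤ 3^{-k}` on all of `Γ_E`.  See the module docstring. -/
theorem tower_baseChange (h₁ : baseChange_cyclic_cuspidal)
    (h₂ : ArthurClozel1989_strongLifting_unramified) (h₃ : ArthurClozel1989_strongLifting_archimedean)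
    (h₄ : exists_galoisRep_of_regularAlgebraic)
    {F E : Type} [Field F] [NumberField F] [Field E] [NumberField E] [Algebra F E]
    (h2 : Module.finrank F E = 2) (hFCM : IsTotallyReal F ∨ IsCMField F)
    {c : E ≃ₐ[ℚ] E} {c₀ : F ≃ₐ[ℚ] F} (hcc₀ : ∀ x : F, c (algebraMap F E x) = algebraMap F E (c₀ x))
    (𝔐 : Ideal (integralClosure ℤ ℂ)) (ι : PadicAlgCl 3 ≃+* ℂ)
    (hι : ∀ (z : integralClosure ℤ ℂ) (k : ℕ),
      (∃ u : integralClosure ℤ ℂ, u ∉ 𝔐 ∧ u * z ∈ Ideal.span {(3 : integralClosure ℤ ℂ) ^ k}) →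
      ‖ι.symm (z : ℂ)‖ ≤ ((3 : ℝ)⁻¹) ^ k)
    (hcpt : isCompact_glFiniteIntegralLevel 3 F) (hcptE : isCompact_glFiniteIntegralLevel 3 E)
    (S S₀ : Finset (HeightOneSpectrum (𝓞 F))) (a : HeightOneSpectrum (𝓞 F) → ℂ)
    (ρ : FramedGaloisRep F (PadicAlgCl 3) 3)
    (hS₀ : ∀ v : HeightOneSpectrum (𝓞 F), ((3 : ℕ) : 𝓞 F) ∈ v.asIdeal → v ∈ S₀)
    (hρ : ∀ 𝔭 ∉ S₀, ρ.IsUnramifiedAt 𝔭 ∧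
      ∀ 𝔓 ∈ 𝔭.primesAbove, ∀ τ : Field.absoluteGaloisGroup F,
        IsArithFrobAt (𝓞 F) τ 𝔓 → FramedRep.trace ρ τ⁻¹ = ι.symm (a 𝔭))
    (htower : ∀ k : ℕ, ∃ P : CuspidalAutomorphicRepData 3 F hcpt,
      P.1.IsRegularAlgebraic ∧ P.1.IsConjSelfDualAE c₀ ∧
      ∀ 𝔭 ∉ S, ∃ (α : Multiset ℂ) (t u : integralClosure ℤ ℂ), P.1.HasSatakeParamAt 𝔭 α ∧
        (t : ℂ) = (𝔭.residueCard : ℂ) * α.sum - a 𝔭 ∧ u ∉ 𝔐 ∧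
        u * t ∈ Ideal.span {(3 : integralClosure ℤ ℂ) ^ k}) :
    ∃ S_E : Finset (HeightOneSpectrum (𝓞 E)),
      (∀ w : HeightOneSpectrum (𝓞 E), ((3 : ℕ) : 𝓞 E) ∈ w.asIdeal → w ∈ S_E) ∧
      (∀ w : HeightOneSpectrum (𝓞 E), w.under (𝓞 F) ∈ S₀ → w ∈ S_E) ∧
      ∀ k : ℕ, ∃ (P : CuspidalAutomorphicRepData 3 E hcptE) (r : FramedGaloisRep E (PadicAlgCl 3) 3),
        P.1.IsRegularAlgebraic ∧ P.1.IsConjSelfDualAE c ∧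
        (∀ w ∉ S_E, P.1.IsUnramifiedAt w ∧ IsGaloisCompatibleAt P.1 ι r w) ∧
        ∀ g : Field.absoluteGaloisGroup E,
          ‖FramedRep.trace r g - FramedRep.trace (ρ.restrictField E) g‖ ≤ ((3 : ℝ)⁻¹) ^ k := by
  haveI : FiniteDimensional F E := Module.finite_of_finrank_eq_succ h2
  haveI : Algebra.IsQuadraticExtension F E := ⟨h2⟩
  haveI : IsGalois F E := inferInstance
  have hprime : (Module.finrank F E).Prime := by rw [h2]; exact Nat.prime_two
  -- the level over `E`: places over `T = S ∪ S₀ ∪ Ram(E/F)`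
  have hfinR : {v : HeightOneSpectrum (𝓞 F) | ¬ Algebra.IsUnramifiedIn (𝓞 E) v.asIdeal}.Finite :=
    finite_setOf_not_isUnramifiedIn F E
  set T : Finset (HeightOneSpectrum (𝓞 F)) := S ∪ S₀ ∪ hfinR.toFinset with hT
  have hfinE : {w : HeightOneSpectrum (𝓞 E) | w.under (𝓞 F) ∈ T}.Finite := by
    refine (Set.Finite.biUnion T.finite_toSet fun v _ => finite_setOf_under_eq (M := E) v).subset ?_
    intro w hw
    exact Set.mem_biUnion hw rfl
  have hmemT : ∀ w : HeightOneSpectrum (𝓞 E), w ∉ hfinE.toFinset →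
      w.under (𝓞 F) ∉ S ∧ w.under (𝓞 F) ∉ S₀ ∧
        Algebra.IsUnramifiedIn (𝓞 E) (w.under (𝓞 F)).asIdeal := by
    intro w hw
    simp only [Set.Finite.mem_toFinset, Set.mem_setOf_eq, hT, Finset.mem_union, not_or,
      not_not] at hw
    exact ⟨hw.1.1, hw.1.2, hw.2⟩
  have h3under : ∀ w : HeightOneSpectrum (𝓞 E), ((3 : ℕ) : 𝓞 E) ∈ w.asIdeal →
      ((3 : ℕ) : 𝓞 F) ∈ (w.under (𝓞 F)).asIdeal := fun w hw => by
    rw [HeightOneSpectrum.under_asIdeal, Ideal.under, Ideal.mem_comap, map_natCast]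
    exact hw
  refine ⟨hfinE.toFinset, fun w hw => ?_, fun w hw => ?_, fun k => ?_⟩
  · rw [Set.Finite.mem_toFinset, Set.mem_setOf_eq, hT, Finset.mem_union, Finset.mem_union]
    exact Or.inl (Or.inr (hS₀ _ (h3under w hw)))
  · rw [Set.Finite.mem_toFinset, Set.mem_setOf_eq, hT, Finset.mem_union, Finset.mem_union]
    exact Or.inl (Or.inr hw)
  -- the `k`-th member of the tower and its cuspidal base change
  obtain ⟨P, hPreg, hPcsd, hPS⟩ := htower k
  obtain ⟨v₁, w₁, α₁, hw₁, hf₁, hα₁, hne₁⟩ := exists_inert_hasSatakeParamAt h2 (by decide) P.1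
  obtain ⟨BC, hBC⟩ := h₁ 3 F E hprime hcpt P ⟨v₁, w₁, α₁, hw₁, hf₁, hα₁, hne₁⟩ hcptE
  have hU : IsUnramifiedBaseChangeLift P.1 BC.1 := h₂.isUnramifiedBaseChangeLift hprime hBC
  have hBCreg : BC.1.IsRegularAlgebraic := hU.isRegularAlgebraic h₃ hprime hPreg
  -- the Galois representation of `P` over `F` (lang.S27) and its restriction to `Γ_E`
  obtain ⟨rF, -, hrFc⟩ := h₄ hcpt hFCM P hPreg 3 ι
  refine ⟨BC, rF.restrictField E, hBCreg, isConjSelfDualAE_of_isUnramifiedBaseChangeLift hU hcc₀ hPcsd,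
    fun w hw => ?_, fun g => ?_⟩
  · -- unramifiedness and compatibility at `w ∉ S_E`
    obtain ⟨hwS, hwS₀, hwu⟩ := hmemT w hw
    have h3 : ((3 : ℕ) : 𝓞 F) ∉ (w.under (𝓞 F)).asIdeal := fun h => hwS₀ (hS₀ _ h)
    obtain ⟨α, -, -, hα, -⟩ := hPS _ hwS
    refine ⟨hU.isUnramifiedAt (v := w.under (𝓞 F)) rfl hwu ⟨α, hα⟩, ?_⟩
    exact isGaloisCompatibleAt_restrictField P.1 BC.1 ι rF (v := w.under (𝓞 F)) rfl hα
      (hU w (w.under (𝓞 F)) α rfl hwu hα) fun β hβ => hrFc _ β hβ h3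
  · -- the sup-norm bound, over `Γ_F` by density of the Frobenii off `S ∪ S₀`, then on `Γ_E`
    have hF : ∀ g : Field.absoluteGaloisGroup F,
        ‖FramedRep.trace rF g - FramedRep.trace ρ g‖ ≤ ((3 : ℝ)⁻¹) ^ k := by
      refine norm_trace_sub_le_of_frobenius (↑(S ∪ S₀) : Set (HeightOneSpectrum (𝓞 F)))
        (S ∪ S₀).finite_toSet rF ρ _ fun v hv 𝔓 h𝔓 σ hσ => ?_
      simp only [Finset.coe_union, Set.mem_union, Finset.mem_coe, not_or] at hv
      obtain ⟨hvS, hvS₀⟩ := hv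
      have h3 : ((3 : ℕ) : 𝓞 F) ∉ v.asIdeal := fun h => hvS₀ (hS₀ _ h)
      obtain ⟨α, t, u, hα, ht, hu, hut⟩ := hPS v hvS
      rw [trace_inv_eq_of_isGaloisCompatibleAt ι (fun β hβ => hrFc v β hβ h3) hα h𝔓 hσ,
        (hρ v hvS₀).2 𝔓 h𝔓 σ hσ, ← map_sub, ← ht]
      exact hι t k ⟨u, hu, hut⟩
    exact hF (absGaloisRestrict F E g)

/-! ## The registered stub, conditionally -/

/-- **Stub 4 of the line `split-ramified-prime-sqrt6` (`stub_baseChangeToL`), registered signature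
verbatim, CONDITIONAL on the four named facts** `baseChange_cyclic_cuspidal`,
`ArthurClozel1989_strongLifting_unramified`, `ArthurClozel1989_strongLifting_archimedean`,
`exists_galoisRep_of_regularAlgebraic`: with the CM field `L = K[X]/(X² + 2) ⊇ K`, `s = √-2` and the
involution `c` (`s ↦ -s`, `c|_K = c₀`) of `exists_cmField_sqrt_neg_two` (support file
`…BaseChangeToLField`) and `hcptL = isCompact_glFiniteIntegralLevel_holds`, the conclusion is
`tower_baseChange` for `E = L`, `F = K` (a CM field). -/
theorem stub_baseChangeToL :
    baseChange_cyclic_cuspidal → ArthurClozel1989_strongLifting_unramified →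
    ArthurClozel1989_strongLifting_archimedean → exists_galoisRep_of_regularAlgebraic →
    ∀ (𝔐 : Ideal (integralClosure ℤ ℂ)), 𝔐.IsMaximal → (3 : integralClosure ℤ ℂ) ∈ 𝔐 →
    ∀ (ι : PadicAlgCl 3 ≃+* ℂ),
      (∀ (z : integralClosure ℤ ℂ) (k : ℕ),
        (∃ u : integralClosure ℤ ℂ, u ∉ 𝔐 ∧ u * z ∈ Ideal.span {(3 : integralClosure ℤ ℂ) ^ k}) →
        ‖ι.symm (z : ℂ)‖ ≤ ((3 : ℝ)⁻¹) ^ k) →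
    ∀ (hcpt : isCompact_glFiniteIntegralLevel 3 (CyclotomicField 3 ℚ))
      (c₀ : CyclotomicField 3 ℚ ≃ₐ[ℚ] CyclotomicField 3 ℚ), c₀ ≠ 1 →
    ∀ (S S₀ : Finset (HeightOneSpectrum (𝓞 (CyclotomicField 3 ℚ))))
      (a : HeightOneSpectrum (𝓞 (CyclotomicField 3 ℚ)) → ℂ)
      (ρ : FramedGaloisRep (CyclotomicField 3 ℚ) (PadicAlgCl 3) 3),
      (∀ v : HeightOneSpectrum (𝓞 (CyclotomicField 3 ℚ)),
        ((3 : ℕ) : 𝓞 (CyclotomicField 3 ℚ)) ∈ v.asIdeal → v ∈ S₀) →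
      (∀ 𝔭 ∉ S₀, ρ.IsUnramifiedAt 𝔭 ∧
        ∀ 𝔓 ∈ 𝔭.primesAbove, ∀ τ : Field.absoluteGaloisGroup (CyclotomicField 3 ℚ),
          IsArithFrobAt (𝓞 (CyclotomicField 3 ℚ)) τ 𝔓 → FramedRep.trace ρ τ⁻¹ = ι.symm (a 𝔭)) →
      (∀ k : ℕ, ∃ P : CuspidalAutomorphicRepData 3 (CyclotomicField 3 ℚ) hcpt,
        P.1.IsRegularAlgebraic ∧ P.1.IsConjSelfDualAE c₀ ∧
        ∀ 𝔭 ∉ S, ∃ (α : Multiset ℂ) (t u : integralClosure ℤ ℂ), P.1.HasSatakeParamAt 𝔭 α ∧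
          (t : ℂ) = (𝔭.residueCard : ℂ) * α.sum - a 𝔭 ∧ u ∉ 𝔐 ∧
          u * t ∈ Ideal.span {(3 : integralClosure ℤ ℂ) ^ k}) →
    ∃ (L : Type) (_ : Field L) (_ : NumberField L) (_ : Algebra (CyclotomicField 3 ℚ) L)
      (s : L) (c : L ≃ₐ[ℚ] L) (hcptL : isCompact_glFiniteIntegralLevel 3 L)
      (S_L : Finset (HeightOneSpectrum (𝓞 L))),
      NumberField.IsCMField L ∧ s ^ 2 = -2 ∧ Module.finrank (CyclotomicField 3 ℚ) L = 2 ∧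
      c s = -s ∧
      (∀ x : CyclotomicField 3 ℚ,
        c (algebraMap (CyclotomicField 3 ℚ) L x) = algebraMap (CyclotomicField 3 ℚ) L (c₀ x)) ∧
      (∀ w : HeightOneSpectrum (𝓞 L), ((3 : ℕ) : 𝓞 L) ∈ w.asIdeal → w ∈ S_L) ∧
      (∀ w : HeightOneSpectrum (𝓞 L), w.under (𝓞 (CyclotomicField 3 ℚ)) ∈ S₀ → w ∈ S_L) ∧
      ∀ k : ℕ, ∃ (P : CuspidalAutomorphicRepData 3 L hcptL)
        (r : FramedGaloisRep L (PadicAlgCl 3) 3),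
        P.1.IsRegularAlgebraic ∧ P.1.IsConjSelfDualAE c ∧
        (∀ w ∉ S_L, P.1.IsUnramifiedAt w ∧ IsGaloisCompatibleAt P.1 ι r w) ∧
        ∀ g : Field.absoluteGaloisGroup L,
          ‖FramedRep.trace r g - FramedRep.trace (ρ.restrictField L) g‖ ≤ ((3 : ℝ)⁻¹) ^ k := by
  intro h₁ h₂ h₃ h₄ 𝔐 _ _ ι hι hcpt c₀ hc₀ S S₀ a ρ hS₀ hρ htower
  have hKCM : IsCMField (CyclotomicField 3 ℚ) :=
    haveI : IsCyclotomicExtension {3} ℚ (CyclotomicField 3 ℚ) :=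
      CyclotomicField.isCyclotomicExtension 3 ℚ
    IsCyclotomicExtension.Rat.isCMField (CyclotomicField 3 ℚ) (S := {3}) ⟨3, rfl, by norm_num⟩
  obtain ⟨L, _, _, _, s, c, hCM, hs, h2, hcs, hcc₀⟩ := exists_cmField_sqrt_neg_two c₀ hc₀
  obtain ⟨S_L, hSL3, hSLS₀, hk⟩ := tower_baseChange h₁ h₂ h₃ h₄ (F := CyclotomicField 3 ℚ) (E := L)
    h2 (Or.inr hKCM) (c := c) (c₀ := c₀) hcc₀ 𝔐 ι hι hcpt (isCompact_glFiniteIntegralLevel_holds 3 L)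
    S S₀ a ρ hS₀ hρ htower
  exact ⟨L, inferInstance, inferInstance, inferInstance, s, c, isCompact_glFiniteIntegralLevel_holds 3 L,
    S_L, hCM, hs, h2, hcs, hcc₀, hSL3, hSLS₀, hk⟩

end Summit.Langlands.Langlands.Theorems.IrregularClassicality.SplitRamifiedPrimeSqrt6

end
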